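import Mathlib.Analysis.LocallyConvex.Separation
import Mathlib.Analysis.SpecialFunctions.Pow.Real
import Mathlib.LinearAlgebra.QuadraticForm.Basic
import Mathlib.LinearAlgebra.FiniteDimensional.Lemmas
import Mathlib.Topology.Order.Compact
import HarnessLib

/-!
# Dines' theorem and Yuan's lemma (joint range of two real quadratic forms)

Two classical facts from the theory of quadratic optimisation (the "S-lemma" circle of ideas),
proved in full:

* **Dines' theorem** (L. L. Dines, 1941): for any two real quadratic forms `q_A, q_B` on a real
  vector space `E`, the *joint range* `{(q_A x, q_B x) : x ∈ E} ⊆ ℝ²` is convex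
  (`convex_jointRange`).
* **Yuan's lemma** (Y. Yuan, 1990, Lemma 2.3; reproduced as Lemma 2.7 of Pólik–Terlaky,
  *A survey of the S-lemma*, SIAM Review 49 (2007)): if `max (q_A x) (q_B x) ≥ 0` for every `x`,
  then some convex combination `μ q_A + (1 − μ) q_B` (`μ ∈ [0, 1]`) is positive semidefinite
  (`yuan_lemma`). (Pólik–Terlaky state it for closed sets `F ∪ G = ℝⁿ` with `q_A ≥ 0` on `F`,
  `q_B ≥ 0` on `G`; the form here is the case `F = {q_A ≥ 0}`, `G = {q_B ≥ 0}`, over an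
  arbitrary real vector space.)

## Proofs

Dines: it suffices to realise, for `x, y ∈ E` and `a, b ≥ 0`, the point
`a · (q_A x, q_B x) + b · (q_A y, q_B y)` as the image of some `s x + t y`; since
`q (s x + t y) = s² q x + s t · polar q x y + t² q y`, this is the purely two-dimensional
statement `exists_sq_smul_combination`: for `P, M, R ∈ ℝ²` and `a, b ≥ 0` there are reals
`s, t` with `s² P + s t M + t² R = a P + b R`. We prove the latter by the rank-reduction
argument for semidefinite programs: the triples `(σ, τ, ω)` with `σ P + τ M + ω R = a P + b R`
form a line through `(a, 0, b)` (three unknowns, two equations), and moving along this line inside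
the cone `{σ, ω ≥ 0, τ² ≤ σ ω}` of positive semidefinite `2 × 2` matrices until its boundary is
hit produces a singular such matrix, i.e. one of the form `(s², s t, t²)`.

Yuan: by Dines the joint range is a convex set disjoint from the open negative quadrant; the
geometric Hahn–Banach theorem in `ℝ²` separates them by a functional `(p, q) ↦ μ₁ p + μ₂ q`
with `μ₁, μ₂ ≥ 0` not both zero, nonnegative on the joint range (which is a cone).

## References

* L. L. Dines, *On the mapping of quadratic forms*, Bull. Amer. Math. Soc. 47 (1941) 494–498.
* Y. Yuan, *On a subproblem of trust region algorithms for constrained optimization*,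
  Math. Programming 47 (1990) 53–63, Lemma 2.3.
* I. Pólik, T. Terlaky, *A survey of the S-lemma*, SIAM Review 49 (2007) 371–418, §2
  (Prop. 2.3 = Dines' theorem, Lemma 2.7 = Yuan's lemma; read via `lit read
  doi:10.1137/S003614450444614X`, pp. 6, 11–12).
-/

namespace Literature.Analysis.Convexity

open Set

/-! ### The two-dimensional core -/

section TwoD

/-- The segment of the line `u ↦ (a + u d₁, u d₂, b + u d₃)` (in the space of symmetric
`2 × 2` matrices `[[σ, τ], [τ, ω]]`) that lies in the positive semidefinite cone:
`σ ≥ 0`, `ω ≥ 0`, `τ² ≤ σ ω`. [folklore] -/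
def PsdLine (a b d₁ d₂ d₃ u : ℝ) : Prop :=
  0 ≤ a + u * d₁ ∧ 0 ≤ b + u * d₃ ∧ (u * d₂) ^ 2 ≤ (a + u * d₁) * (b + u * d₃)

/-- Reversing the direction of the line reverses the parameter. [folklore] -/
theorem psdLine_neg (a b d₁ d₂ d₃ u : ℝ) :
    PsdLine a b (-d₁) (-d₂) (-d₃) (-u) ↔ PsdLine a b d₁ d₂ d₃ u := by
  simp only [PsdLine, neg_mul_neg]

/-- The feasible segment is a closed set of parameters. [folklore] -/
theorem isClosed_psdLine (a b d₁ d₂ d₃ : ℝ) : IsClosed {u : ℝ | PsdLine a b d₁ d₂ d₃ u} := by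
  have h1 : IsClosed {u : ℝ | 0 ≤ a + u * d₁} := isClosed_le continuous_const (by fun_prop)
  have h2 : IsClosed {u : ℝ | 0 ≤ b + u * d₃} := isClosed_le continuous_const (by fun_prop)
  have h3 : IsClosed {u : ℝ | (u * d₂) ^ 2 ≤ (a + u * d₁) * (b + u * d₃)} :=
    isClosed_le (by fun_prop) (by fun_prop)
  simpa only [PsdLine, setOf_and] using h1.inter (h2.inter h3)

/-- The strictly feasible parameters form an open set. [folklore] -/
theorem isOpen_psdLine_strict (a b d₁ d₂ d₃ : ℝ) :
    IsOpen {u : ℝ | 0 < a + u * d₁ ∧ 0 < b + u * d₃ ∧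
      (u * d₂) ^ 2 < (a + u * d₁) * (b + u * d₃)} := by
  have h1 : IsOpen {u : ℝ | 0 < a + u * d₁} := isOpen_lt continuous_const (by fun_prop)
  have h2 : IsOpen {u : ℝ | 0 < b + u * d₃} := isOpen_lt continuous_const (by fun_prop)
  have h3 : IsOpen {u : ℝ | (u * d₂) ^ 2 < (a + u * d₁) * (b + u * d₃)} :=
    isOpen_lt (by fun_prop) (by fun_prop)
  simpa only [setOf_and] using h1.inter (h2.inter h3)

/-- A nonzero direction leaves the positive semidefinite cone at some nonzero parameter.
[folklore] -/
theorem exists_not_psdLine {a b d₁ d₂ d₃ : ℝ} (ha : 0 ≤ a) (hb : 0 ≤ b)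
    (hd : ¬ (d₁ = 0 ∧ d₂ = 0 ∧ d₃ = 0)) :
    ∃ u₀ : ℝ, u₀ ≠ 0 ∧ ¬ PsdLine a b d₁ d₂ d₃ u₀ := by
  by_cases h₁ : d₁ = 0
  · by_cases h₃ : d₃ = 0
    · have h₂ : d₂ ≠ 0 := fun h₂ => hd ⟨h₁, h₂, h₃⟩
      refine ⟨(a * b + 1) / d₂, div_ne_zero (by positivity) h₂, ?_⟩
      rintro ⟨-, -, h⟩
      rw [div_mul_cancel₀ _ h₂, h₁, h₃] at h
      nlinarith [mul_nonneg ha hb]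
    · refine ⟨-(b + 1) / d₃, div_ne_zero (by linarith) h₃, ?_⟩
      rintro ⟨-, h, -⟩
      rw [div_mul_cancel₀ _ h₃] at h
      linarith
  · refine ⟨-(a + 1) / d₁, div_ne_zero (by linarith) h₁, ?_⟩
    rintro ⟨h, -, -⟩
    rw [div_mul_cancel₀ _ h₁] at h
    linarith

/-- **Rank reduction along a line.** If the direction `(d₁, d₂, d₃)` is in the kernel of
`(σ, τ, ω) ↦ σ P + τ M + ω R` and the line through `(a, 0, b)` leaves the positive semidefinite
cone at some positive parameter, then the cone's boundary contains a point of the line: a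
singular positive semidefinite `(σ, τ, ω)` with `σ P + τ M + ω R = a P + b R`.
[cite: PolikTerlaky2007, §2.2 Prop. 2.3 (rank-one reduction as in Lemma 2.4)] -/
theorem exists_singular_psd_of_exit {P M R : ℝ × ℝ} {a b d₁ d₂ d₃ u₀ : ℝ} (ha : 0 ≤ a)
    (hb : 0 ≤ b) (hker : d₁ • P + d₂ • M + d₃ • R = 0) (hu₀ : 0 < u₀)
    (hnot : ¬ PsdLine a b d₁ d₂ d₃ u₀) :
    ∃ σ τ ω : ℝ, 0 ≤ σ ∧ 0 ≤ ω ∧ τ ^ 2 = σ * ω ∧ σ • P + τ • M + ω • R = a • P + b • R := by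
  set U : Set ℝ := {u | PsdLine a b d₁ d₂ d₃ u} ∩ Icc 0 u₀ with hU
  have h0 : (0 : ℝ) ∈ U :=
    ⟨⟨by simpa using ha, by simpa using hb, by simpa using mul_nonneg ha hb⟩, le_rfl, hu₀.le⟩
  have hclosed : IsClosed U := (isClosed_psdLine a b d₁ d₂ d₃).inter isClosed_Icc
  have hbdd : BddAbove U := ⟨u₀, fun u hu => hu.2.2⟩
  set us := sSup U with hus_def
  have hus : us ∈ U := hclosed.csSup_mem ⟨0, h0⟩ hbdd
  obtain ⟨⟨hσ, hω, hdet⟩, -, husu₀⟩ := hus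
  have hlt : us < u₀ := lt_of_le_of_ne husu₀ fun h => hnot (h ▸ ⟨hσ, hω, hdet⟩)
  have hus0 : 0 ≤ us := le_csSup hbdd h0
  -- at the last feasible parameter the matrix is singular
  have hdet0 : (us * d₂) ^ 2 = (a + us * d₁) * (b + us * d₃) := by
    by_contra hne
    have hpos : (us * d₂) ^ 2 < (a + us * d₁) * (b + us * d₃) := lt_of_le_of_ne hdet hne
    have hprod : 0 < (a + us * d₁) * (b + us * d₃) := lt_of_le_of_lt (sq_nonneg _) hpos
    have hσ' : 0 < a + us * d₁ := by
      rcases hσ.lt_or_eq with h | h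
      · exact h
      · rw [← h, zero_mul] at hprod
        exact absurd hprod (lt_irrefl 0)
    have hω' : 0 < b + us * d₃ := by
      rcases hω.lt_or_eq with h | h
      · exact h
      · rw [← h, mul_zero] at hprod
        exact absurd hprod (lt_irrefl 0)
    -- strictly feasible parameters form an open set containing `us`
    have hmem : us ∈ {u : ℝ | 0 < a + u * d₁ ∧ 0 < b + u * d₃ ∧
        (u * d₂) ^ 2 < (a + u * d₁) * (b + u * d₃)} := ⟨hσ', hω', hpos⟩
    obtain ⟨ε, hε, hball⟩ := Metric.isOpen_iff.mp (isOpen_psdLine_strict a b d₁ d₂ d₃) us hmem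
    set u := min (us + ε / 2) u₀ with hu
    have hu_gt : us < u := lt_min (by linarith) hlt
    have hu_ball : u ∈ Metric.ball us ε := by
      rw [Metric.mem_ball, Real.dist_eq, abs_of_pos (by linarith)]
      have : u ≤ us + ε / 2 := min_le_left _ _
      linarith
    obtain ⟨h1, h2, h3⟩ := hball hu_ball
    have huU : u ∈ U := ⟨⟨h1.le, h2.le, h3.le⟩, by linarith, min_le_right _ _⟩
    exact absurd (le_csSup hbdd huU) (not_le.mpr hu_gt)
  refine ⟨a + us * d₁, us * d₂, b + us * d₃, hσ, hω, hdet0, ?_⟩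
  have hsplit : (a + us * d₁) • P + (us * d₂) • M + (b + us * d₃) • R =
      a • P + b • R + us • (d₁ • P + d₂ • M + d₃ • R) := by
    simp only [add_smul, mul_smul, smul_add]
    abel
  rw [hsplit, hker, smul_zero, add_zero]

/-- A singular positive semidefinite `[[σ, τ], [τ, ω]]` is `[[s², s t], [s t, t²]]`.
[folklore] -/
theorem exists_sq_of_singular_psd {σ τ ω : ℝ} (hσ : 0 ≤ σ) (hω : 0 ≤ ω) (h : τ ^ 2 = σ * ω) :
    ∃ s t : ℝ, s ^ 2 = σ ∧ s * t = τ ∧ t ^ 2 = ω := by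
  have hst : Real.sqrt σ * Real.sqrt ω = |τ| := by
    rw [← Real.sqrt_mul hσ, ← h, Real.sqrt_sq_eq_abs]
  refine ⟨Real.sqrt σ, if 0 ≤ τ then Real.sqrt ω else -Real.sqrt ω, Real.sq_sqrt hσ, ?_, ?_⟩
  · split_ifs with hτ
    · rw [hst, abs_of_nonneg hτ]
    · rw [mul_neg, hst, abs_of_neg (not_le.mp hτ), neg_neg]
  · split_ifs
    · exact Real.sq_sqrt hω
    · rw [neg_sq, Real.sq_sqrt hω]

/-- Three vectors in the plane are linearly dependent: the map `(σ, τ, ω) ↦ σ P + τ M + ω R`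
from `ℝ³` to `ℝ²` has a nonzero kernel vector. [folklore] -/
theorem exists_ker_vector (P M R : ℝ × ℝ) :
    ∃ d₁ d₂ d₃ : ℝ, ¬ (d₁ = 0 ∧ d₂ = 0 ∧ d₃ = 0) ∧ d₁ • P + d₂ • M + d₃ • R = 0 := by
  let f : (Fin 3 → ℝ) →ₗ[ℝ] ℝ × ℝ :=
    (LinearMap.proj 0).smulRight P + (LinearMap.proj 1).smulRight M +
      (LinearMap.proj 2).smulRight R
  have hf : LinearMap.ker f ≠ ⊥ := LinearMap.ker_ne_bot_of_finrank_lt (by simp)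
  obtain ⟨d, hd, hne⟩ := (Submodule.ne_bot_iff _).mp hf
  refine ⟨d 0, d 1, d 2, ?_, by simpa [f] using hd⟩
  rintro ⟨h0, h1, h2⟩
  apply hne
  funext i
  fin_cases i <;> assumption

/-- **The two-dimensional core of Dines' theorem.** For `P, M, R ∈ ℝ²` and `a, b ≥ 0` there
are reals `s, t` with `s² P + s t M + t² R = a P + b R` (the case `n = 2` of Dines' theorem,
applied to the three coefficient vectors of a pair of binary forms). [cite: PolikTerlaky2007, Prop. 2.3] -/
theorem exists_sq_smul_combination (P M R : ℝ × ℝ) {a b : ℝ} (ha : 0 ≤ a) (hb : 0 ≤ b) :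
    ∃ s t : ℝ, s ^ 2 • P + (s * t) • M + t ^ 2 • R = a • P + b • R := by
  obtain ⟨d₁, d₂, d₃, hd, hker⟩ := exists_ker_vector P M R
  obtain ⟨u₀, hu₀, hnot⟩ := exists_not_psdLine ha hb hd
  -- orient the line so that it leaves the cone at a positive parameter
  obtain ⟨σ, τ, ω, hσ, hω, hdet, hsum⟩ :
      ∃ σ τ ω : ℝ, 0 ≤ σ ∧ 0 ≤ ω ∧ τ ^ 2 = σ * ω ∧ σ • P + τ • M + ω • R = a • P + b • R := by
    rcases lt_or_gt_of_ne hu₀ with hneg | hpos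
    · refine exists_singular_psd_of_exit (d₁ := -d₁) (d₂ := -d₂) (d₃ := -d₃) ha hb ?_
        (neg_pos.mpr hneg) ((psdLine_neg a b d₁ d₂ d₃ u₀).not.mpr hnot)
      simp only [neg_smul, ← neg_add, hker, neg_zero]
    · exact exists_singular_psd_of_exit ha hb hker hpos hnot
  obtain ⟨s, t, hs, hst, ht⟩ := exists_sq_of_singular_psd hσ hω hdet
  exact ⟨s, t, by rw [hs, hst, ht, hsum]⟩

end TwoD

/-! ### Dines' theorem -/

section Dines

variable {E : Type*} [AddCommGroup E] [Module ℝ E]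

/-- The **joint range** `{(q_A x, q_B x) : x ∈ E}` of two real quadratic forms (Dines' set `M`).
[cite: PolikTerlaky2007, Prop. 2.3] -/
def jointRange (QA QB : QuadraticForm ℝ E) : Set (ℝ × ℝ) :=
  Set.range fun x => (QA x, QB x)

/-- Membership in the joint range (definitional). [folklore] -/
theorem mem_jointRange {QA QB : QuadraticForm ℝ E} {p : ℝ × ℝ} :
    p ∈ jointRange QA QB ↔ ∃ x, (QA x, QB x) = p := Iff.rfl

/-- A quadratic form on a two-dimensional family: `q (s x + t y) = s² q x + s t · polar + t² q y`.
[folklore] -/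
theorem quadraticMap_apply_smul_add_smul (Q : QuadraticForm ℝ E) (s t : ℝ) (x y : E) :
    Q (s • x + t • y) = s ^ 2 * Q x + s * t * QuadraticMap.polar Q x y + t ^ 2 * Q y := by
  rw [QuadraticMap.map_add (⇑Q) (s • x) (t • y), QuadraticMap.map_smul, QuadraticMap.map_smul,
    QuadraticMap.polar_smul_left, QuadraticMap.polar_smul_right]
  simp only [smul_eq_mul]
  ring

/-- **Dines' theorem** (Dines 1941; Pólik–Terlaky Prop. 2.3 / Thm 5.1: "If `f, g : ℝⁿ → ℝ` are
homogeneous quadratic functions, then the set `M = {(f(x), g(x)) : x ∈ ℝⁿ} ⊂ ℝ²` is convex"),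
here over an arbitrary real vector space. [cite: PolikTerlaky2007, Prop. 2.3] -/
theorem convex_jointRange (QA QB : QuadraticForm ℝ E) : Convex ℝ (jointRange QA QB) := by
  rintro _ ⟨x, rfl⟩ _ ⟨y, rfl⟩ a b ha hb -
  obtain ⟨s, t, hst⟩ := exists_sq_smul_combination (QA x, QB x)
    (QuadraticMap.polar QA x y, QuadraticMap.polar QB x y) (QA y, QB y) ha hb
  refine ⟨s • x + t • y, ?_⟩
  change (QA (s • x + t • y), QB (s • x + t • y)) = a • (QA x, QB x) + b • (QA y, QB y)
  rw [← hst, quadraticMap_apply_smul_add_smul, quadraticMap_apply_smul_add_smul]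
  ext <;> simp [smul_eq_mul]

/-- The joint range is a cone: it contains `0` … [folklore] -/
theorem zero_mem_jointRange (QA QB : QuadraticForm ℝ E) : (0 : ℝ × ℝ) ∈ jointRange QA QB :=
  ⟨0, by simp⟩

/-- … and is closed under multiplication by squares. [folklore] -/
theorem sq_smul_mem_jointRange (QA QB : QuadraticForm ℝ E) {p : ℝ × ℝ}
    (hp : p ∈ jointRange QA QB) (c : ℝ) : (c ^ 2) • p ∈ jointRange QA QB := by
  obtain ⟨x, rfl⟩ := hp
  exact ⟨c • x, by simp [QuadraticMap.map_smul, sq, smul_eq_mul]⟩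

end Dines

/-! ### Yuan's lemma -/

section Yuan

variable {E : Type*} [AddCommGroup E] [Module ℝ E]

/-- **Yuan's lemma** (Yuan 1990, Lemma 2.3; Pólik–Terlaky 2007, Lemma 2.7 with `F = {q_A ≥ 0}`,
`G = {q_B ≥ 0}`). If two real quadratic forms satisfy `max (q_A x) (q_B x) ≥ 0` for every `x`,
then there is `μ ∈ [0, 1]` with `μ q_A x + (1 − μ) q_B x ≥ 0` for every `x`.
[cite: PolikTerlaky2007, Lemma 2.7] -/
theorem yuan_lemma (QA QB : QuadraticForm ℝ E) (h : ∀ x, 0 ≤ QA x ∨ 0 ≤ QB x) :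
    ∃ μ : ℝ, 0 ≤ μ ∧ μ ≤ 1 ∧ ∀ x, 0 ≤ μ * QA x + (1 - μ) * QB x := by
  set K := jointRange QA QB with hK_def
  have hK : Convex ℝ K := convex_jointRange QA QB
  set S : Set (ℝ × ℝ) := Iio 0 ×ˢ Iio 0 with hS_def
  have hS1 : Convex ℝ S := (convex_Iio 0).prod (convex_Iio 0)
  have hS2 : IsOpen S := isOpen_Iio.prod isOpen_Iio
  have hdisj : Disjoint S K := by
    rw [Set.disjoint_left]
    rintro _ ⟨h1, h2⟩ ⟨x, rfl⟩
    rcases h x with hx | hx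
    · exact absurd hx (not_le.mpr h1)
    · exact absurd hx (not_le.mpr h2)
  obtain ⟨f, u, hfS, hfK⟩ := geometric_hahn_banach_open hS1 hS2 hK hdisj
  set μ₁ := f (1, 0) with hμ₁
  set μ₂ := f (0, 1) with hμ₂
  have hf : ∀ p : ℝ × ℝ, f p = p.1 * μ₁ + p.2 * μ₂ := by
    intro p
    have hp : p = p.1 • ((1, 0) : ℝ × ℝ) + p.2 • ((0, 1) : ℝ × ℝ) := by ext <;> simp
    conv_lhs => rw [hp]
    rw [map_add, map_smul, map_smul, smul_eq_mul, smul_eq_mul]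
  have hu : u ≤ 0 := by simpa using hfK 0 (zero_mem_jointRange QA QB)
  -- the functional is nonnegative on the cone `K`
  have hK0 : ∀ p ∈ K, 0 ≤ f p := by
    intro p hp
    by_contra hneg
    push Not at hneg
    set c := Real.sqrt (u / f p) + 1 with hc
    have hc2 : u / f p < c ^ 2 := by
      have h1 : Real.sqrt (u / f p) < c := by linarith
      have h0 : 0 ≤ Real.sqrt (u / f p) := Real.sqrt_nonneg _
      calc u / f p = Real.sqrt (u / f p) ^ 2 := (Real.sq_sqrt (div_nonneg_of_nonpos hu hneg.le)).symm
        _ < c ^ 2 := by gcongr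
    have hlt : c ^ 2 * f p < u := by
      have := mul_lt_mul_of_neg_right hc2 hneg
      rwa [div_mul_cancel₀ _ hneg.ne] at this
    have hge : u ≤ f ((c ^ 2) • p) := hfK _ (sq_smul_mem_jointRange QA QB hp c)
    rw [map_smul, smul_eq_mul] at hge
    linarith
  -- the coefficients are nonnegative
  have hμ₁ : 0 ≤ μ₁ := by
    by_contra hneg
    push Not at hneg
    set N := max 1 ((μ₂ + u + 1) / (-μ₁)) with hN
    have hN1 : (μ₂ + u + 1) / (-μ₁) ≤ N := le_max_right _ _
    have hN2 : μ₂ + u + 1 ≤ N * (-μ₁) := by rwa [div_le_iff₀ (neg_pos.mpr hneg)] at hN1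
    have hmem : ((-N, -1) : ℝ × ℝ) ∈ S :=
      ⟨by simp only [mem_Iio]; linarith [le_max_left (1 : ℝ) ((μ₂ + u + 1) / (-μ₁))],
        by simp only [mem_Iio]; norm_num⟩
    have := hfS _ hmem
    rw [hf] at this
    simp only at this
    linarith
  have hμ₂ : 0 ≤ μ₂ := by
    by_contra hneg
    push Not at hneg
    set N := max 1 ((μ₁ + u + 1) / (-μ₂)) with hN
    have hN1 : (μ₁ + u + 1) / (-μ₂) ≤ N := le_max_right _ _
    have hN2 : μ₁ + u + 1 ≤ N * (-μ₂) := by rwa [div_le_iff₀ (neg_pos.mpr hneg)] at hN1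
    have hmem : ((-1, -N) : ℝ × ℝ) ∈ S :=
      ⟨by simp only [mem_Iio]; norm_num,
        by simp only [mem_Iio]; linarith [le_max_left (1 : ℝ) ((μ₁ + u + 1) / (-μ₂))]⟩
    have := hfS _ hmem
    rw [hf] at this
    simp only at this
    linarith
  have hsum : 0 < μ₁ + μ₂ := by
    have hmem : ((-1, -1) : ℝ × ℝ) ∈ S := ⟨by simp only [mem_Iio]; norm_num, by simp only [mem_Iio]; norm_num⟩
    have := hfS _ hmem
    rw [hf] at this
    simp only at this
    rcases (add_nonneg hμ₁ hμ₂).lt_or_eq with hlt | heq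
    · exact hlt
    · linarith
  refine ⟨μ₁ / (μ₁ + μ₂), div_nonneg hμ₁ hsum.le, (div_le_one hsum).mpr (by linarith), ?_⟩
  intro x
  have hx : 0 ≤ QA x * μ₁ + QB x * μ₂ := by
    have := hK0 _ ⟨x, rfl⟩
    rwa [hf] at this
  have h1 : 1 - μ₁ / (μ₁ + μ₂) = μ₂ / (μ₁ + μ₂) := by
    field_simp
    ring
  rw [h1, div_mul_eq_mul_div, div_mul_eq_mul_div, ← add_div]
  apply div_nonneg _ hsum.le
  linarith

/-- Yuan's lemma in `max`-form, with the combination written as `μ q_A + ν q_B`,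
`μ, ν ≥ 0`, `μ + ν = 1`. [cite: PolikTerlaky2007, Lemma 2.7] -/
theorem yuan_lemma' (QA QB : QuadraticForm ℝ E) (h : ∀ x, 0 ≤ max (QA x) (QB x)) :
    ∃ μ ν : ℝ, 0 ≤ μ ∧ 0 ≤ ν ∧ μ + ν = 1 ∧ ∀ x, 0 ≤ μ * QA x + ν * QB x := by
  obtain ⟨μ, h0, h1, hμ⟩ := yuan_lemma QA QB fun x => le_max_iff.mp (h x)
  exact ⟨μ, 1 - μ, h0, by linarith, by ring, hμ⟩

end Yuan

end Literature.Analysis.Convexity
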